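/-
Copyright (c) 2026. All rights reserved.
Released under Apache 2.0 license as described in the file LICENSE.
Authors: abc-iut cell, IUT REPAIR branch seat abc-iut-rp-x2 (gen 4).
-/
import Literature.IUT.LogVolume.DifferentEstimatesCorollaries
import HarnessLib

/-!
# [IUTchIV] Prop. 1.2 constants `a`, `b` — and `d + a + b` at a tamely ramified place — in CLOSED FORM by integer arithmetic

Proof-only companion (no definition, no named fact; classical arithmetic, nothing disputed) of
`RamificationInvariants.lean` (`logRadiusA p e = a`, `logRadiusB p e = b`, the exponents of [IUTchIV] Prop. 1.2 p. 10:
`a := (1/e)·⌈e/(p−2)⌉` for `p > 2`, `a := 2` for `p = 2`; `b := ⌊log(p·e/(p−1))/log(p)⌋ − 1/e`) and of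
`DifferentEstimatesCorollaries.lean` (`differentOrd_eq_of_not_dvd`: `p ∤ e ⇒ d = (e−1)/e`).

The tree so far evaluates `a`, `b` only in the TAME range `1 ≤ e ≤ p − 2` (`logRadiusA_eq`, `logRadiusB_eq`: `a = 1/e = −b`)
and otherwise BOUNDS them (`logRadiusB_le`, `logRadiusA_le_two`, `depthConstants_lt`, `logRadiusB_le_sharp`). Tables of the
constants at concrete places (e.g. ramification index `e ≥ p − 1`, the typical situation at a place of multiplicative reduction
of small residue characteristic after adjoining `l`-torsion) want the EXACT values by decidable integer comparisons, with no
real logarithm left to evaluate. This file supplies them: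

* §1 `logRadiusA_eq_of_window`: `(c−1)(p−2) < e ≤ c(p−2) ⇒ a = c/e`; `logRadiusA_eq_ceilDiv`: `a = ((e + p − 3)/(p − 2))/e`
  (natural-number division); `logRadiusA_two`.
* §2 `logRadiusB_eq_of_window`: `p^k·(p−1) ≤ p·e < p^{k+1}·(p−1) ⇒ b = k − 1/e`; `logRadiusB_eq_natLog`: for `e ≥ p − 1`,
  `b = Nat.log p (e/(p−1)) + 1 − 1/e`; the band `p − 1 ≤ e < p(p−1) ⇒ b = 1 − 1/e` (`logRadiusB_eq_one_sub`);
  `p = 2`: `b = Nat.log 2 e + 1 − 1/e` (`logRadiusB_two_eq`).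
* §3 `logRadiusA_add_logRadiusB_eq_of_windows` and, for a `p`-adic field `K` with `p ∤ e_K` (tamely ramified, ANY `e_K`),
  `depthConstants_eq_of_not_dvd`: `d + a + b = (e + c − 2)/e + k` — an exact value where only inequalities were available.
* §4 worked instances (`example`s): `(p, e) = (5, 7)`, `(7, 77)`, `(2, 12)`, `(3, 2)`.

Sources: [IUTchIV] = S. Mochizuki, *Inter-universal Teichmüller theory IV*, §1 Prop. 1.2 (kurims p. 10) for the definitions
of `a`, `b`; J.-P. Serre, *Corps locaux*, Ch. III §6 Prop. 13 for `d = (e−1)/e` at `p ∤ e`. What is NOT here: any statement about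
wildly ramified differents beyond the existing bounds (`one_le_differentOrd_of_dvd`, `differentOrd_lt`); any log-shell or
log-volume statement (see `LogRadius.lean`, `TensorPacketShell*.lean`).
-/

noncomputable section

namespace Literature.IUT.LogVolume

/-! ## §1. `a = ⌈e/(p−2)⌉/e` by integer arithmetic -/

/-- **Window form of `a`.** For `p > 2`: if `(c − 1)·(p − 2) < e ≤ c·(p − 2)` then `⌈e/(p−2)⌉ = c`, so
`a = logRadiusA p e = c/e`. (For `e ≥ 1` the window forces `c ≥ 1`.) [cite: Mochizuki2012, IUTchIV Prop. 1.2 p. 10] -/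
theorem logRadiusA_eq_of_window {p e c : ℕ} (hp : 2 < p) (he : 1 ≤ e) (hlo : (c - 1) * (p - 2) < e)
    (hhi : e ≤ c * (p - 2)) : logRadiusA p e = (c : ℝ) / e := by
  have hc : 1 ≤ c := by
    rcases Nat.eq_zero_or_pos c with h | h
    · subst h; simp at hhi; omega
    · exact h
  have hp2 : (0 : ℝ) < (p : ℝ) - 2 := by
    have : (2 : ℝ) < p := by exact_mod_cast hp
    linarith
  have h1 : ((c : ℝ) - 1) * ((p : ℝ) - 2) < e := by
    have h := hlo
    rw [Nat.sub_mul, one_mul] at h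
    have h' : c * (p - 2) < e + (p - 2) := by omega
    have h'' : ((c * (p - 2) : ℕ) : ℝ) < ((e + (p - 2) : ℕ) : ℝ) := by exact_mod_cast h'
    rw [Nat.cast_mul, Nat.cast_add, Nat.cast_sub hp.le, Nat.cast_two] at h''
    linarith
  have h2 : (e : ℝ) ≤ (c : ℝ) * ((p : ℝ) - 2) := by
    have h'' : ((e : ℕ) : ℝ) ≤ ((c * (p - 2) : ℕ) : ℝ) := by exact_mod_cast hhi
    rw [Nat.cast_mul, Nat.cast_sub hp.le, Nat.cast_two] at h''
    exact h''
  have hceil : ⌈(e : ℝ) / ((p : ℝ) - 2)⌉ = (c : ℤ) := by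
    rw [Int.ceil_eq_iff, Int.cast_natCast, lt_div_iff₀ hp2, div_le_iff₀ hp2]
    exact ⟨h1, h2⟩
  rw [logRadiusA, if_neg (by omega), hceil, Int.cast_natCast]

/-- **`a` by natural-number division.** For `p > 2` and `e ≥ 1`: `⌈e/(p−2)⌉ = (e + p − 3)/(p − 2)` (division in `ℕ`), so
`a = ((e + p − 3)/(p − 2))/e`. [cite: Mochizuki2012, IUTchIV Prop. 1.2 p. 10] -/
theorem logRadiusA_eq_ceilDiv {p e : ℕ} (hp : 2 < p) (he : 1 ≤ e) :
    logRadiusA p e = (((e + (p - 3)) / (p - 2) : ℕ) : ℝ) / e := by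
  have hn : 0 < p - 2 := by omega
  have h1 : (e + (p - 3)) / (p - 2) * (p - 2) ≤ e + (p - 3) := Nat.div_mul_le_self _ _
  have h2 : e + (p - 3) < (e + (p - 3)) / (p - 2) * (p - 2) + (p - 2) := Nat.lt_div_mul_add hn
  apply logRadiusA_eq_of_window hp he
  · rw [Nat.sub_mul, one_mul]
    generalize (e + (p - 3)) / (p - 2) * (p - 2) = A at h1 h2 ⊢
    omega
  · generalize (e + (p - 3)) / (p - 2) * (p - 2) = A at h1 h2 ⊢
    omega

/-- `p = 2`: `a = 2` by definition. [cite: Mochizuki2012, IUTchIV Prop. 1.2 p. 10] -/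
theorem logRadiusA_two (e : ℕ) : logRadiusA 2 e = 2 := by
  rw [logRadiusA, if_pos rfl]

/-- At the boundary of the tame range, `e = p − 1` with `p ≥ 5`: `⌈(p−1)/(p−2)⌉ = 2`, so `a = 2/(p−1)`.
[cite: Mochizuki2012, IUTchIV Prop. 1.2 p. 10] -/
theorem logRadiusA_eq_of_eq_sub_one {p e : ℕ} (hp : 5 ≤ p) (he : e = p - 1) : logRadiusA p e = 2 / e := by
  have h := logRadiusA_eq_of_window (p := p) (e := e) (c := 2) (by omega) (by omega) (by omega) (by omega)
  simpa using h

/-! ## §2. `b = ⌊log_p(p·e/(p−1))⌋ − 1/e` by integer arithmetic -/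

/-- **Window form of `b`.** For `p > 1`, `e ≥ 1`: if `p^k·(p−1) ≤ p·e < p^{k+1}·(p−1)` — i.e. `p^k ≤ p·e/(p−1) < p^{k+1}` — then
`⌊log(p·e/(p−1))/log(p)⌋ = k`, so `b = logRadiusB p e = k − 1/e`. [cite: Mochizuki2012, IUTchIV Prop. 1.2 p. 10] -/
theorem logRadiusB_eq_of_window {p e k : ℕ} (hp : 1 < p) (he : 1 ≤ e) (hlo : p ^ k * (p - 1) ≤ p * e)
    (hhi : p * e < p ^ (k + 1) * (p - 1)) : logRadiusB p e = (k : ℝ) - 1 / e := by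
  have hp1 : (1 : ℝ) < p := by exact_mod_cast hp
  have hp0 : (0 : ℝ) < p := by linarith
  have hp1' : (0 : ℝ) < (p : ℝ) - 1 := by linarith
  have he' : (0 : ℝ) < e := by exact_mod_cast he
  set x : ℝ := (p : ℝ) * e / ((p : ℝ) - 1) with hx
  have hx0 : 0 < x := div_pos (mul_pos hp0 he') hp1'
  have hlo' : (p : ℝ) ^ k ≤ x := by
    rw [hx, le_div_iff₀ hp1']
    have h : ((p ^ k * (p - 1) : ℕ) : ℝ) ≤ ((p * e : ℕ) : ℝ) := by exact_mod_cast hlo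
    rw [Nat.cast_mul, Nat.cast_pow, Nat.cast_sub hp.le, Nat.cast_one, Nat.cast_mul] at h
    exact h
  have hhi' : x < (p : ℝ) ^ (k + 1) := by
    rw [hx, div_lt_iff₀ hp1']
    have h : ((p * e : ℕ) : ℝ) < ((p ^ (k + 1) * (p - 1) : ℕ) : ℝ) := by exact_mod_cast hhi
    rw [Nat.cast_mul, Nat.cast_mul, Nat.cast_pow, Nat.cast_sub hp.le, Nat.cast_one] at h
    exact h
  have hfloor : ⌊Real.log x / Real.log p⌋ = (k : ℤ) := by
    rw [Real.log_div_log, Int.floor_eq_iff, Int.cast_natCast]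
    constructor
    · rw [Real.le_logb_iff_rpow_le hp1 hx0, Real.rpow_natCast]
      exact hlo'
    · rw [show (k : ℝ) + 1 = ((k + 1 : ℕ) : ℝ) by push_cast; ring, Real.logb_lt_iff_lt_rpow hp1 hx0,
        Real.rpow_natCast]
      exact hhi'
  rw [logRadiusB, ← hx, hfloor, Int.cast_natCast]

/-- **`b` by `Nat.log`.** For `p > 1` and `e ≥ p − 1`: `⌊log(p·e/(p−1))/log(p)⌋ = Nat.log p (e/(p−1)) + 1` (division in `ℕ`),
so `b = Nat.log p (e/(p−1)) + 1 − 1/e`. (For `1 ≤ e ≤ p − 2` the floor is `0` and `b = −1/e`: `logRadiusB_eq`.)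
[cite: Mochizuki2012, IUTchIV Prop. 1.2 p. 10] -/
theorem logRadiusB_eq_natLog {p e : ℕ} (hp : 1 < p) (he : p - 1 ≤ e) :
    logRadiusB p e = ((Nat.log p (e / (p - 1)) + 1 : ℕ) : ℝ) - 1 / e := by
  have hn : 0 < p - 1 := by omega
  have he1 : 1 ≤ e := le_trans (by omega) he
  have hm0 : e / (p - 1) ≠ 0 := (Nat.div_pos he hn).ne'
  have h1 : p ^ Nat.log p (e / (p - 1)) * (p - 1) ≤ e :=
    (Nat.le_div_iff_mul_le hn).1 (Nat.pow_log_le_self p hm0)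
  have h2 : e < p ^ (Nat.log p (e / (p - 1)) + 1) * (p - 1) :=
    (Nat.div_lt_iff_lt_mul hn).1 (Nat.lt_pow_succ_log_self hp _)
  apply logRadiusB_eq_of_window hp he1
  · calc p ^ (Nat.log p (e / (p - 1)) + 1) * (p - 1) = p * (p ^ Nat.log p (e / (p - 1)) * (p - 1)) := by
          rw [pow_succ]; ring
      _ ≤ p * e := Nat.mul_le_mul_left p h1
  · calc p * e < p * (p ^ (Nat.log p (e / (p - 1)) + 1) * (p - 1)) := Nat.mul_lt_mul_of_pos_left h2 (by omega)
      _ = p ^ (Nat.log p (e / (p - 1)) + 1 + 1) * (p - 1) := by rw [pow_succ p (Nat.log p (e / (p - 1)) + 1)]; ring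

/-- **The first non-tame band: `p − 1 ≤ e < p·(p − 1) ⇒ b = 1 − 1/e`.** (E.g. `e = p − 1` itself, or `e = l·e₀` at a residue
characteristic `p` with `p − 1 ≤ l·e₀ < p² − p`.) [cite: Mochizuki2012, IUTchIV Prop. 1.2 p. 10] -/
theorem logRadiusB_eq_one_sub {p e : ℕ} (hp : 1 < p) (hlo : p - 1 ≤ e) (hhi : e < p * (p - 1)) :
    logRadiusB p e = 1 - 1 / e := by
  have he1 : 1 ≤ e := le_trans (by omega) hlo
  have h := logRadiusB_eq_of_window (p := p) (e := e) (k := 1) hp he1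
    (by rw [pow_one]; exact Nat.mul_le_mul_left p hlo)
    (by calc p * e < p * (p * (p - 1)) := Nat.mul_lt_mul_of_pos_left hhi (by omega)
          _ = p ^ (1 + 1) * (p - 1) := by ring)
  simpa using h

/-- **`p = 2`: `b = ⌊log₂(2e)⌋ − 1/e = Nat.log 2 e + 1 − 1/e`** for `e ≥ 1`. [cite: Mochizuki2012, IUTchIV Prop. 1.2 p. 10] -/
theorem logRadiusB_two_eq {e : ℕ} (he : 1 ≤ e) : logRadiusB 2 e = ((Nat.log 2 e + 1 : ℕ) : ℝ) - 1 / e := by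
  have h := logRadiusB_eq_natLog (p := 2) (e := e) one_lt_two (by simpa using he)
  simpa using h

/-! ## §3. `a + b` and `d + a + b` exactly -/

/-- **`a + b` in closed form** (`p > 2`, `e ≥ 1`): with the `a`-window `(c−1)(p−2) < e ≤ c(p−2)` and the `b`-window
`p^k(p−1) ≤ p·e < p^{k+1}(p−1)`, `a + b = (c − 1)/e + k`. [cite: Mochizuki2012, IUTchIV Prop. 1.2 p. 10] -/
theorem logRadiusA_add_logRadiusB_eq_of_windows {p e c k : ℕ} (hp : 2 < p) (he : 1 ≤ e)
    (hloA : (c - 1) * (p - 2) < e) (hhiA : e ≤ c * (p - 2)) (hloB : p ^ k * (p - 1) ≤ p * e)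
    (hhiB : p * e < p ^ (k + 1) * (p - 1)) :
    logRadiusA p e + logRadiusB p e = ((c : ℝ) - 1) / e + k := by
  rw [logRadiusA_eq_of_window hp he hloA hhiA, logRadiusB_eq_of_window (lt_trans one_lt_two hp) he hloB hhiB]
  have he' : (e : ℝ) ≠ 0 := by exact_mod_cast (show e ≠ 0 by omega)
  field_simp
  ring

section PadicField

variable (p : ℕ) [Fact p.Prime]
variable (K : Type*) [NontriviallyNormedField K] [NormedAlgebra ℚ_[p] K] [IsUltrametricDist K] [ProperSpace K]

/-- **`d + a + b` EXACTLY at a tamely ramified place of odd residue characteristic** (`p > 2`, `p ∤ e_K`, ANY `e_K` — in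
particular beyond the tame range `e_K ≤ p − 2`): with `e := e_K = absRamificationIdx p K`, the `a`-window
`(c−1)(p−2) < e ≤ c(p−2)` and the `b`-window `p^k(p−1) ≤ p·e < p^{k+1}(p−1)`,
`d + a + b = (e + c − 2)/e + k` (`d = (e−1)/e` by Serre III §6 Prop. 13, `a = c/e`, `b = k − 1/e`).
[cite: Mochizuki2012, IUTchIV Prop. 1.2 p. 10] [cite: SerreLocalFields1979, Ch. III §6 Prop. 13] -/
theorem depthConstants_eq_of_not_dvd {c k : ℕ} (hp : 2 < p) (h : ¬ p ∣ absRamificationIdx p K)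
    (hloA : (c - 1) * (p - 2) < absRamificationIdx p K) (hhiA : absRamificationIdx p K ≤ c * (p - 2))
    (hloB : p ^ k * (p - 1) ≤ p * absRamificationIdx p K) (hhiB : p * absRamificationIdx p K < p ^ (k + 1) * (p - 1)) :
    differentOrd p K + logRadiusA p (absRamificationIdx p K) + logRadiusB p (absRamificationIdx p K) =
      ((absRamificationIdx p K : ℝ) + c - 2) / absRamificationIdx p K + k := by
  have he := absRamificationIdx_pos p K
  have he' : (absRamificationIdx p K : ℝ) ≠ 0 := by exact_mod_cast he.ne'
  rw [differentOrd_eq_of_not_dvd p K h, add_assoc, logRadiusA_add_logRadiusB_eq_of_windows hp he hloA hhiA hloB hhiB]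
  field_simp
  ring

/-- **`d + a + b` on the first non-tame band at a tamely ramified place**: `p ≥ 5`, `p ∤ e_K`, `p − 1 ≤ e_K < p(p−1)`, with the
`a`-window `(c−1)(p−2) < e_K ≤ c(p−2)`: `d + a + b = (e_K + c − 2)/e_K + 1`.
[cite: Mochizuki2012, IUTchIV Prop. 1.2 p. 10] [cite: SerreLocalFields1979, Ch. III §6 Prop. 13] -/
theorem depthConstants_eq_of_not_dvd_band_one {c : ℕ} (hp : 2 < p) (h : ¬ p ∣ absRamificationIdx p K)
    (hloA : (c - 1) * (p - 2) < absRamificationIdx p K) (hhiA : absRamificationIdx p K ≤ c * (p - 2))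
    (hlo : p - 1 ≤ absRamificationIdx p K) (hhi : absRamificationIdx p K < p * (p - 1)) :
    differentOrd p K + logRadiusA p (absRamificationIdx p K) + logRadiusB p (absRamificationIdx p K) =
      ((absRamificationIdx p K : ℝ) + c - 2) / absRamificationIdx p K + 1 := by
  have h1 := depthConstants_eq_of_not_dvd p K (c := c) (k := 1) hp h hloA hhiA
    (by rw [pow_one]; exact Nat.mul_le_mul_left p hlo)
    (by calc p * absRamificationIdx p K < p * (p * (p - 1)) := Nat.mul_lt_mul_of_pos_left hhi (by omega)
          _ = p ^ (1 + 1) * (p - 1) := by ring)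
  simpa using h1

end PadicField

/-! ## §4. Worked instances (integer arithmetic only) -/

/-- `(p, e) = (5, 7)`: `⌈7/3⌉ = 3`, so `a = 3/7`. -/
example : logRadiusA 5 7 = 3 / 7 := by
  rw [logRadiusA_eq_of_window (c := 3) (by norm_num) (by norm_num) (by norm_num) (by norm_num)]; norm_num

/-- `(p, e) = (5, 7)`: `5¹·4 ≤ 35 < 5²·4`, so `b = 1 − 1/7`. -/
example : logRadiusB 5 7 = 1 - 1 / 7 := by
  rw [logRadiusB_eq_of_window (k := 1) (by norm_num) (by norm_num) (by norm_num) (by norm_num)]; norm_num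

/-- `(p, e) = (7, 77)`: `⌈77/5⌉ = 16`, so `a = 16/77`; `7²·6 ≤ 539 < 7³·6`, so `b = 2 − 1/77`. -/
example : logRadiusA 7 77 = 16 / 77 ∧ logRadiusB 7 77 = 2 - 1 / 77 := by
  constructor
  · rw [logRadiusA_eq_of_window (c := 16) (by norm_num) (by norm_num) (by norm_num) (by norm_num)]; norm_num
  · rw [logRadiusB_eq_of_window (k := 2) (by norm_num) (by norm_num) (by norm_num) (by norm_num)]; norm_num

/-- `(p, e) = (2, 12)`: `2⁴·1 ≤ 24 < 2⁵·1`, so `b = 4 − 1/12` (and `a = 2`). -/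
example : logRadiusA 2 12 = 2 ∧ logRadiusB 2 12 = 4 - 1 / 12 := by
  constructor
  · exact logRadiusA_two 12
  · rw [logRadiusB_eq_of_window (k := 4) (by norm_num) (by norm_num) (by norm_num) (by norm_num)]; norm_num

/-- `(p, e) = (3, 2)` (`e = p − 1`): `⌈2/1⌉ = 2`, `a = 1`; `3·2 ≤ 6 < 9·2`, `b = 1 − 1/2`. -/
example : logRadiusA 3 2 = 1 ∧ logRadiusB 3 2 = 1 - 1 / 2 := by
  constructor
  · rw [logRadiusA_eq_of_window (c := 2) (by norm_num) (by norm_num) (by norm_num) (by norm_num)]; norm_num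
  · rw [logRadiusB_eq_one_sub (by norm_num) (by norm_num) (by norm_num)]; norm_num

end Literature.IUT.LogVolume

end
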